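import Summits.QuantumFields.YangMills.Theorems.ColdStartUniversalityLatticeLangevinWilsonAutocorrelationLogConvex
import Summits.QuantumFields.YangMills.Theorems.ColdStartUniversalityLatticeLangevinLawDensityBound
import Summits.QuantumFields.YangMills.Theorems.ColdStartUniversalityLatticeLangevinDoeblinSZZ
import Summits.QuantumFields.YangMills.Theorems.ColdStartUniversalityLatticeLangevinWilsonInvariantBetaZero
import HarnessLib

/-!
# Route `ColdStartUniversality` (fixed-cut-off `L²(μ_{β'})` package): the semigroup Dirichlet forms at scale `h` of the SZZ
# dynamics at coupling `β'` and at `β' = 0` (Brownian motion on `SU(2)^E`) are COMPARABLE on `C(X)`, uniformly in `h ≤ h₀`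

Helper file (seat `ym-line-csu-p1`, g18; `--supports stmt-QuantumFields-27363`).  For continuous `u` and a realising kernel family
`κ` of the SU(2) lattice Langevin dynamics at `(L, β')` put `Q^{β'}_h(u) := ∫ u² dμ_{β'} − ∫ u κ_h u dμ_{β'} = h 𝓔_h(u)`.

* §1 `dirichletScale_eq_half_double_integral` — `Q_h(u) = ½ ∫∫ (u(x) − u(y))² κ_h(x,dy) μ_{β'}(dx)` (invariance of `μ_{β'}`).
* §2 `exists_transition_integral_le_exp_mul_beta_zero` — TWO-SIDED COMPARISON OF THE TRANSITION LAWS with Brownian motion on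
  `SU(2)^E`: `∫ f dκ^{β'}_t(x,·) ≤ e^{Kt+M} ∫ f dκ^0_t(x,·)` and `∫ f dκ^0_t(x,·) ≤ e^{Kt+M} ∫ f dκ^{β'}_t(x,·)` for continuous `f ≥ 0`,
  all `x, t` (the ground-state sub/super-solution inequalities `integral_le_exp_mul_integral_beta_zero` /
  `integral_le_of_groundState` of g7/g8, read on ANY realising kernel families through `lawUnique_of_start`).
* §3 ★★ `exists_dirichletScale_le_mul_beta_zero` — hence `Q^{β'}_h(u) ≤ C e^{Kh} Q^0_h(u)` and `Q^0_h(u) ≤ C e^{Kh} Q^{β'}_h(u)` for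
  all continuous `u` and all `h` (`μ_{β'}` and Haar dominate each other; `μ_0 =` product Haar): the closed semigroup Dirichlet
  forms at `β'` and at `0` have THE SAME DOMAIN with equivalent norms — the Holley–Stroock comparison at the level of the
  SEMIGROUP forms, where no core is needed.

THEOREMS ONLY, no definition, no sorry.  HONEST FRAMING: RECORD-rung R3 plumbing at FIXED cut-off (the constants are
`exp(O(β' L³))`); nothing K-uniform is proved; no crux, rung or summit statement is proved; the Yang–Mills mass gap is NOT proved.
-/

set_option autoImplicit false

noncomputable section

namespace Summit.QuantumFields.YangMills.Theorems.ColdStartUniversality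

open MeasureTheory ProbabilityTheory Filter Set Topology
open scoped BigOperators NNReal ENNReal
open Literature.Probability.Process Literature.MathematicalPhysics.QuantumFieldTheory
open Literature.MathematicalPhysics.QuantumLattice (fundamentalRep fundamentalLatticeRep continuous_fundamentalRep)

variable {L : ℕ} [NeZero L]

/-! ## §1. The double-integral form of `Q_h` -/

/-- `∫ (u(x) − u(y))² κ_h(x,dy) = u(x)² − 2 u(x) κ_h u(x) + κ_h(u²)(x)` for continuous `u` (every Markov kernel). [folklore] -/
theorem integral_sub_sq_transition {κh : Kernel (GaugeConfig 3 L (Matrix.specialUnitaryGroup (Fin 2) ℂ))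
      (GaugeConfig 3 L (Matrix.specialUnitaryGroup (Fin 2) ℂ))} [IsMarkovKernel κh]
    {u : GaugeConfig 3 L (Matrix.specialUnitaryGroup (Fin 2) ℂ) → ℝ} (hu : Continuous u)
    (x : GaugeConfig 3 L (Matrix.specialUnitaryGroup (Fin 2) ℂ)) :
    ∫ y, (u x - u y) ^ 2 ∂(κh x) = u x * u x - 2 * (u x * ∫ y, u y ∂(κh x)) + ∫ y, u y * u y ∂(κh x) := by
  have hint : ∀ {w : GaugeConfig 3 L (Matrix.specialUnitaryGroup (Fin 2) ℂ) → ℝ}, Continuous w → Integrable w (κh x) := by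
    intro w hw
    obtain ⟨M', -, hM'⟩ := exists_abs_le_of_continuous hw
    exact Integrable.of_bound hw.aestronglyMeasurable M' (Eventually.of_forall fun z => by rw [Real.norm_eq_abs]; exact hM' z)
  have e : ∀ y, (u x - u y) ^ 2 = (u x * u x - 2 * u x * u y) + u y * u y := by intro y; ring
  simp_rw [e]
  have i1 : Integrable (fun _ : GaugeConfig 3 L (Matrix.specialUnitaryGroup (Fin 2) ℂ) => u x * u x) (κh x) :=
    integrable_const _
  have i2 : Integrable (fun y => 2 * u x * u y) (κh x) := (hint hu).const_mul _
  have i12 : Integrable (fun y => u x * u x - 2 * u x * u y) (κh x) := i1.sub i2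
  have i3 : Integrable (fun y => u y * u y) (κh x) := hint (hu.mul hu)
  rw [integral_add i12 i3, integral_sub i1 i2, integral_const, integral_const_mul, probReal_univ, one_smul]
  ring

/-- `x ↦ ∫ (u(x) − u(y))² κ_h(x,dy)` is continuous and non-negative for continuous `u` (Feller property). [folklore] -/
theorem continuous_integral_sub_sq_transition (L : ℕ) [NeZero L] (β' : ℝ)
    (κ : ℝ≥0 → Kernel (GaugeConfig 3 L (Matrix.specialUnitaryGroup (Fin 2) ℂ))
      (GaugeConfig 3 L (Matrix.specialUnitaryGroup (Fin 2) ℂ))) [∀ t, IsMarkovKernel (κ t)]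
    (hreal : ∀ (t : ℝ≥0) (x : GaugeConfig 3 L (Matrix.specialUnitaryGroup (Fin 2) ℂ))
        (Ω : Type) [MeasurableSpace Ω] (P : Measure Ω) [IsProbabilityMeasure P]
        (W : ℝ≥0 → Ω → (Edge 3 L × NoiseIdx 2 → ℝ)) (hW : IsFlatBrownian W P)
        (U : ℝ≥0 → Ω → GaugeConfig 3 L (Matrix.specialUnitaryGroup (Fin 2) ℂ)),
        (∀ ω, U 0 ω = x) →
        (latticeLangevinDynamics (fundamentalLatticeRep 2) β').IsSolution (fundamentalRep (Fin 2))
          hW.natFiltration P W U →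
        κ t x = P.map (U t))
    (h : ℝ≥0) {u : GaugeConfig 3 L (Matrix.specialUnitaryGroup (Fin 2) ℂ) → ℝ} (hu : Continuous u) :
    Continuous (fun x => ∫ y, (u x - u y) ^ 2 ∂(κ h x)) ∧ ∀ x, 0 ≤ ∫ y, (u x - u y) ^ 2 ∂(κ h x) := by
  refine ⟨?_, fun x => integral_nonneg fun y => sq_nonneg _⟩
  have e : (fun x => ∫ y, (u x - u y) ^ 2 ∂(κ h x)) =
      fun x => u x * u x - 2 * (u x * ∫ y, u y ∂(κ h x)) + ∫ y, u y * u y ∂(κ h x) :=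
    funext fun x => integral_sub_sq_transition hu x
  rw [e]
  exact (((hu.mul hu).sub (continuous_const.mul (hu.mul (continuous_integral_transitionKernel L β' κ hreal h hu)))).add
    (continuous_integral_transitionKernel L β' κ hreal h (hu.mul hu)))

/-- **`Q_h(u) = ½ ∫∫ (u(x) − u(y))² κ_h(x,dy) μ_{β'}(dx)`** for continuous `u`: expand the square and use the invariance
`∫ κ_h(u²) dμ_{β'} = ∫ u² dμ_{β'}`. [cite: BakryGentilLedoux2014, (1.7.1)–(1.7.2)] -/
theorem dirichletScale_eq_half_double_integral (L : ℕ) [NeZero L] (β' : ℝ)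
    (κ : ℝ≥0 → Kernel (GaugeConfig 3 L (Matrix.specialUnitaryGroup (Fin 2) ℂ))
      (GaugeConfig 3 L (Matrix.specialUnitaryGroup (Fin 2) ℂ))) [∀ t, IsMarkovKernel (κ t)]
    (hreal : ∀ (t : ℝ≥0) (x : GaugeConfig 3 L (Matrix.specialUnitaryGroup (Fin 2) ℂ))
        (Ω : Type) [MeasurableSpace Ω] (P : Measure Ω) [IsProbabilityMeasure P]
        (W : ℝ≥0 → Ω → (Edge 3 L × NoiseIdx 2 → ℝ)) (hW : IsFlatBrownian W P)
        (U : ℝ≥0 → Ω → GaugeConfig 3 L (Matrix.specialUnitaryGroup (Fin 2) ℂ)),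
        (∀ ω, U 0 ω = x) →
        (latticeLangevinDynamics (fundamentalLatticeRep 2) β').IsSolution (fundamentalRep (Fin 2))
          hW.natFiltration P W U →
        κ t x = P.map (U t))
    (h : ℝ≥0) {u : GaugeConfig 3 L (Matrix.specialUnitaryGroup (Fin 2) ℂ) → ℝ} (hu : Continuous u) :
    (∫ x, u x * u x ∂(wilsonMeasure (d := 3) (L := L) (fundamentalRep (Fin 2)) β')) -
        ∫ x, u x * (∫ y, u y ∂(κ h x)) ∂(wilsonMeasure (d := 3) (L := L) (fundamentalRep (Fin 2)) β') =
      1 / 2 * ∫ x, (∫ y, (u x - u y) ^ 2 ∂(κ h x)) ∂(wilsonMeasure (d := 3) (L := L) (fundamentalRep (Fin 2)) β') := by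
  classical
  haveI := secondCountableTopology_su2
  haveI := borelSpace_config L
  set μ : Measure (GaugeConfig 3 L (Matrix.specialUnitaryGroup (Fin 2) ℂ)) :=
    wilsonMeasure (d := 3) (L := L) (fundamentalRep (Fin 2)) β' with hμ
  haveI : IsProbabilityMeasure μ :=
    isProbabilityMeasure_wilsonMeasure (d := 3) (L := L) (fundamentalRep (Fin 2)) (continuous_fundamentalRep (Fin 2)) β'
  obtain ⟨M, -, hM⟩ := exists_abs_le_of_continuous hu
  have hu2c : Continuous fun y => u y * u y := hu.mul hu
  have hint : ∀ {w : GaugeConfig 3 L (Matrix.specialUnitaryGroup (Fin 2) ℂ) → ℝ}, Continuous w →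
      ∀ (ν : Measure (GaugeConfig 3 L (Matrix.specialUnitaryGroup (Fin 2) ℂ))) [IsProbabilityMeasure ν], Integrable w ν := by
    intro w hw ν _
    obtain ⟨M', -, hM'⟩ := exists_abs_le_of_continuous hw
    exact Integrable.of_bound hw.aestronglyMeasurable M' (Eventually.of_forall fun z => by rw [Real.norm_eq_abs]; exact hM' z)
  set Ku : GaugeConfig 3 L (Matrix.specialUnitaryGroup (Fin 2) ℂ) → ℝ := fun x => ∫ y, u y ∂(κ h x) with hKu
  set Ku2 : GaugeConfig 3 L (Matrix.specialUnitaryGroup (Fin 2) ℂ) → ℝ := fun x => ∫ y, u y * u y ∂(κ h x) with hKu2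
  have hKuc : Continuous Ku := continuous_integral_transitionKernel L β' κ hreal h hu
  have hKu2c : Continuous Ku2 := continuous_integral_transitionKernel L β' κ hreal h hu2c
  -- the inner integral
  have hinner : ∀ x, ∫ y, (u x - u y) ^ 2 ∂(κ h x) = u x * u x - 2 * (u x * Ku x) + Ku2 x := fun x =>
    integral_sub_sq_transition hu x
  simp_rw [hinner]
  -- invariance: `∫ κ_h(u²) dμ = ∫ u² dμ`
  have hinv : ∫ x, Ku2 x ∂μ = ∫ x, u x * u x ∂μ :=
    integral_transitionKernel_integral_eq_wilson (L := L) β' κ hreal h hu2c.measurable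
      ⟨M * M, fun x => by rw [abs_mul]; exact mul_le_mul (hM x) (hM x) (abs_nonneg _) ((abs_nonneg _).trans (hM x))⟩
  have iuu : Integrable (fun x => u x * u x) μ := integrable_of_continuous_of_compactSpace hu2c μ
  have iuK : Integrable (fun x => 2 * (u x * Ku x)) μ := (integrable_of_continuous_of_compactSpace (hu.mul hKuc) μ).const_mul _
  have iK2 : Integrable Ku2 μ := integrable_of_continuous_of_compactSpace hKu2c μ
  have i12 : Integrable (fun x => u x * u x - 2 * (u x * Ku x)) μ := iuu.sub iuK
  rw [integral_add i12 iK2, integral_sub iuu iuK, integral_const_mul, hinv]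
  ring

/-! ## §2. Two-sided comparison of the transition laws with Brownian motion on `SU(2)^E` -/

/-- **The `β'` transition laws and the heat-kernel laws dominate each other**: there are `K, M` (depending on `L, β'` only)
such that for ANY realising kernel families `κ` (coupling `β'`) and `κ⁰` (coupling `0`), every continuous `f ≥ 0`, every `x`
and every `t`: `∫ f dκ_t(x,·) ≤ e^{Kt+M} ∫ f dκ⁰_t(x,·)` and `∫ f dκ⁰_t(x,·) ≤ e^{Kt+M} ∫ f dκ_t(x,·)` — the ground-state
sub/super-solution comparisons `integral_le_exp_mul_integral_beta_zero` / `integral_le_of_groundState` on the regular flows of the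
product Wiener space, transported by `hreal`. [folklore] -/
theorem exists_transition_integral_le_exp_mul_beta_zero (L : ℕ) [NeZero L] (β' : ℝ) :
    ∃ K M : ℝ, ∀ (κ : ℝ≥0 → Kernel (GaugeConfig 3 L (Matrix.specialUnitaryGroup (Fin 2) ℂ))
        (GaugeConfig 3 L (Matrix.specialUnitaryGroup (Fin 2) ℂ))) [∀ t, IsMarkovKernel (κ t)],
      (∀ (t : ℝ≥0) (x : GaugeConfig 3 L (Matrix.specialUnitaryGroup (Fin 2) ℂ))
        (Ω : Type) [MeasurableSpace Ω] (P : Measure Ω) [IsProbabilityMeasure P]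
        (W : ℝ≥0 → Ω → (Edge 3 L × NoiseIdx 2 → ℝ)) (hW : IsFlatBrownian W P)
        (U : ℝ≥0 → Ω → GaugeConfig 3 L (Matrix.specialUnitaryGroup (Fin 2) ℂ)),
        (∀ ω, U 0 ω = x) →
        (latticeLangevinDynamics (fundamentalLatticeRep 2) β').IsSolution (fundamentalRep (Fin 2))
          hW.natFiltration P W U →
        κ t x = P.map (U t)) →
      ∀ (κ₀ : ℝ≥0 → Kernel (GaugeConfig 3 L (Matrix.specialUnitaryGroup (Fin 2) ℂ))
        (GaugeConfig 3 L (Matrix.specialUnitaryGroup (Fin 2) ℂ))) [∀ t, IsMarkovKernel (κ₀ t)],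
      (∀ (t : ℝ≥0) (x : GaugeConfig 3 L (Matrix.specialUnitaryGroup (Fin 2) ℂ))
        (Ω : Type) [MeasurableSpace Ω] (P : Measure Ω) [IsProbabilityMeasure P]
        (W : ℝ≥0 → Ω → (Edge 3 L × NoiseIdx 2 → ℝ)) (hW : IsFlatBrownian W P)
        (U : ℝ≥0 → Ω → GaugeConfig 3 L (Matrix.specialUnitaryGroup (Fin 2) ℂ)),
        (∀ ω, U 0 ω = x) →
        (latticeLangevinDynamics (fundamentalLatticeRep 2) 0).IsSolution (fundamentalRep (Fin 2))
          hW.natFiltration P W U →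
        κ₀ t x = P.map (U t)) →
      ∀ (f : GaugeConfig 3 L (Matrix.specialUnitaryGroup (Fin 2) ℂ) → ℝ), Continuous f → (∀ y, 0 ≤ f y) →
      ∀ (x : GaugeConfig 3 L (Matrix.specialUnitaryGroup (Fin 2) ℂ)) (t : ℝ≥0),
        ∫ y, f y ∂(κ t x) ≤ Real.exp (K * t + M) * ∫ y, f y ∂(κ₀ t x) ∧
        ∫ y, f y ∂(κ₀ t x) ≤ Real.exp (K * t + M) * ∫ y, f y ∂(κ t x) := by
  classical
  haveI := secondCountableTopology_su2
  haveI := borelSpace_config L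
  haveI := isProbabilityMeasure_piWiener (Edge 3 L × NoiseIdx 2)
  have hWc := isFlatBrownian_piWiener 3 L (NoiseIdx 2)
  obtain ⟨X, GX, hX, hXm, -, -, -⟩ := exists_regularFlow L β' hWc
  obtain ⟨Y, GY, hY, hYm, -, -, -⟩ := exists_regularFlow L 0 hWc
  obtain ⟨K₁, M₁, hup⟩ := integral_le_exp_mul_integral_beta_zero (L := L) β' hWc X hX hXm hWc Y hY hYm
  obtain ⟨K₂, M₂, hlow, -⟩ := integral_le_of_groundState (L := L) β' hWc X hX hXm hWc Y hY hYm
    (f := fun _ => 0) continuous_const (fun _ => le_rfl) (fun _ => zero_le_one) (fun _ => 1) 0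
  refine ⟨max K₁ K₂, max M₁ M₂, fun κ _ hreal κ₀ _ hreal₀ f hf hf0 x t => ?_⟩
  -- transport to the regular flows
  have hκ : κ t x = (Measure.pi fun _ : Edge 3 L × NoiseIdx 2 => preWienerMeasure).map (X x t) :=
    hreal t x _ _ _ hWc (X x) (hX x).1 (hX x).2
  have hκ₀ : κ₀ t x = (Measure.pi fun _ : Edge 3 L × NoiseIdx 2 => preWienerMeasure).map (Y x t) :=
    hreal₀ t x _ _ _ hWc (Y x) (hY x).1 (hY x).2
  have hmX : Measurable (X x t) := ((hX x).2.adapted t).mono (hWc.natFiltration.le t) le_rfl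
  have hmY : Measurable (Y x t) := ((hY x).2.adapted t).mono (hWc.natFiltration.le t) le_rfl
  rw [hκ, hκ₀, integral_map hmX.aemeasurable hf.aestronglyMeasurable, integral_map hmY.aemeasurable hf.aestronglyMeasurable]
  -- normalise `f` to `[0, 1]`
  obtain ⟨Mf, hMf0, hMf⟩ := exists_abs_le_of_continuous hf
  set c : ℝ := Mf + 1 with hc
  have hcpos : 0 < c := by rw [hc]; linarith
  set g : GaugeConfig 3 L (Matrix.specialUnitaryGroup (Fin 2) ℂ) → ℝ := fun y => c⁻¹ * f y with hg
  have hgc : Continuous g := continuous_const.mul hf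
  have hg0 : ∀ y, 0 ≤ g y := fun y => mul_nonneg (inv_nonneg.2 hcpos.le) (hf0 y)
  have hg1 : ∀ y, g y ≤ 1 := fun y => by
    rw [hg]; dsimp only
    rw [inv_mul_le_iff₀ hcpos, mul_one]
    exact ((le_abs_self _).trans (hMf y)).trans (by rw [hc]; linarith)
  have hfg : ∀ y, f y = c * g y := fun y => by rw [hg]; dsimp only; rw [← mul_assoc, mul_inv_cancel₀ hcpos.ne', one_mul]
  set P₀ : Measure (Edge 3 L × NoiseIdx 2 → ℝ≥0 → ℝ) := Measure.pi fun _ : Edge 3 L × NoiseIdx 2 => preWienerMeasure with hP₀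
  have hIfX : ∫ ω, f (X x t ω) ∂P₀ = c * ∫ ω, g (X x t ω) ∂P₀ := by
    rw [← integral_const_mul]; exact integral_congr_ae (Eventually.of_forall fun ω => hfg _)
  have hIfY : ∫ ω, f (Y x t ω) ∂P₀ = c * ∫ ω, g (Y x t ω) ∂P₀ := by
    rw [← integral_const_mul]; exact integral_congr_ae (Eventually.of_forall fun ω => hfg _)
  rw [hIfX, hIfY]
  have h1 := hup g hgc hg0 hg1 x t
  have h2 := hlow g hgc hg0 hg1 x t
  -- enlarge the constants
  have hexp1 : Real.exp (K₁ * t + M₁) ≤ Real.exp (max K₁ K₂ * t + max M₁ M₂) :=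
    Real.exp_le_exp.2 (add_le_add (mul_le_mul_of_nonneg_right (le_max_left _ _) t.2) (le_max_left _ _))
  have hexp2 : Real.exp (K₂ * t + M₂) ≤ Real.exp (max K₁ K₂ * t + max M₁ M₂) :=
    Real.exp_le_exp.2 (add_le_add (mul_le_mul_of_nonneg_right (le_max_right _ _) t.2) (le_max_right _ _))
  have hIY : 0 ≤ ∫ ω', g (Y x t ω') ∂P₀ := integral_nonneg fun _ => hg0 _
  have hIX : 0 ≤ ∫ ω, g (X x t ω) ∂P₀ := integral_nonneg fun _ => hg0 _
  constructor
  · -- upper comparison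
    have h1' : ∫ ω, g (X x t ω) ∂P₀ ≤ Real.exp (max K₁ K₂ * t + max M₁ M₂) * ∫ ω', g (Y x t ω') ∂P₀ :=
      h1.trans (mul_le_mul_of_nonneg_right hexp1 hIY)
    calc c * ∫ ω, g (X x t ω) ∂P₀ ≤ c * (Real.exp (max K₁ K₂ * t + max M₁ M₂) * ∫ ω', g (Y x t ω') ∂P₀) :=
          mul_le_mul_of_nonneg_left h1' hcpos.le
      _ = _ := by ring
  · -- lower comparison: `e^{-K₂t-M₂} ∫ g(Y) ≤ ∫ g(X)`
    have h2' : ∫ ω', g (Y x t ω') ∂P₀ ≤ Real.exp (K₂ * t + M₂) * ∫ ω, g (X x t ω) ∂P₀ := by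
      have hpos : 0 < Real.exp (-(K₂ * t) - M₂) := Real.exp_pos _
      have e : Real.exp (K₂ * t + M₂) = (Real.exp (-(K₂ * t) - M₂))⁻¹ := by
        rw [← Real.exp_neg]; congr 1; ring
      rw [e, ← div_eq_inv_mul, le_div_iff₀ hpos, mul_comm]
      exact h2
    have h2'' := h2'.trans (mul_le_mul_of_nonneg_right hexp2 hIX)
    calc c * ∫ ω', g (Y x t ω') ∂P₀ ≤ c * (Real.exp (max K₁ K₂ * t + max M₁ M₂) * ∫ ω, g (X x t ω) ∂P₀) :=
          mul_le_mul_of_nonneg_left h2'' hcpos.le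
      _ = _ := by ring

/-! ## §3. The semigroup Dirichlet forms at `β'` and at `0` are comparable -/

/-- Integrating a continuous non-negative function against a dominated measure: `μ ≤ a • ν ⇒ ∫ g dμ ≤ a ∫ g dν`. [folklore] -/
theorem integral_le_mul_integral_of_le_smul {X : Type*} [MeasurableSpace X] [TopologicalSpace X] [CompactSpace X]
    [OpensMeasurableSpace X] {μ ν : Measure X} [IsFiniteMeasure ν] {a : ℝ} (ha : 0 ≤ a)
    (hle : μ ≤ (ENNReal.ofReal a) • ν) {g : X → ℝ} (hg : Continuous g) (hg0 : ∀ x, 0 ≤ g x) :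
    ∫ x, g x ∂μ ≤ a * ∫ x, g x ∂ν := by
  haveI : IsFiniteMeasure ((ENNReal.ofReal a) • ν) :=
    ⟨by rw [Measure.smul_apply, smul_eq_mul]; exact ENNReal.mul_lt_top ENNReal.ofReal_lt_top (measure_lt_top _ _)⟩
  have hgi : Integrable g ((ENNReal.ofReal a) • ν) := by
    obtain ⟨M, -, hM⟩ := exists_abs_le_of_continuous_of_compactSpace hg
    exact Integrable.of_bound hg.aestronglyMeasurable M (Eventually.of_forall fun z => by rw [Real.norm_eq_abs]; exact hM z)
  calc ∫ x, g x ∂μ ≤ ∫ x, g x ∂((ENNReal.ofReal a) • ν) :=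
        integral_mono_measure hle (Eventually.of_forall fun x => hg0 x) hgi
    _ = a * ∫ x, g x ∂ν := by rw [integral_smul_measure, ENNReal.toReal_ofReal ha, smul_eq_mul]

/-- ★★ **The semigroup Dirichlet forms at scale `h` of the SZZ dynamics at coupling `β'` and at coupling `0` are comparable on
`C(X)`**: there are `K` and `C > 0` (depending on `L, β'` only) such that for ANY realising kernel families `κ` (coupling `β'`),
`κ⁰` (coupling `0`), every continuous `u` and every `h`,
`Q^{β'}_h(u) ≤ C e^{Kh} Q^0_h(u)` and `Q^0_h(u) ≤ C e^{Kh} Q^{β'}_h(u)`, `Q^{β}_h(u) = ∫ u² dμ_β − ∫ u κ^β_h u dμ_β = h 𝓔^β_h(u)`.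
Proof: double-integral form + the two-sided comparison of the transition laws (`exists_transition_integral_le_exp_mul_beta_zero`)
+ `μ_{β'} ≍ Haar^{⊗E} = μ_0` (`wilsonMeasure_le_smul_pi_haar_and`, `wilsonMeasure_zero_eq_pi`).  Consequence: the closed
semigroup forms `sup_h 𝓔^{β'}_h` and `sup_h 𝓔^0_h` are finite on the same continuous functions (Holley–Stroock at the level of
SEMIGROUP forms — no core, no generator). [cite: BakryGentilLedoux2014, Prop. 4.2.7 and §1.15.7 (Holley–Stroock)] -/
theorem exists_dirichletScale_le_mul_beta_zero (L : ℕ) [NeZero L] (β' : ℝ) :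
    ∃ K C : ℝ, 0 < C ∧ ∀ (κ : ℝ≥0 → Kernel (GaugeConfig 3 L (Matrix.specialUnitaryGroup (Fin 2) ℂ))
        (GaugeConfig 3 L (Matrix.specialUnitaryGroup (Fin 2) ℂ))) [∀ t, IsMarkovKernel (κ t)],
      (∀ (t : ℝ≥0) (x : GaugeConfig 3 L (Matrix.specialUnitaryGroup (Fin 2) ℂ))
        (Ω : Type) [MeasurableSpace Ω] (P : Measure Ω) [IsProbabilityMeasure P]
        (W : ℝ≥0 → Ω → (Edge 3 L × NoiseIdx 2 → ℝ)) (hW : IsFlatBrownian W P)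
        (U : ℝ≥0 → Ω → GaugeConfig 3 L (Matrix.specialUnitaryGroup (Fin 2) ℂ)),
        (∀ ω, U 0 ω = x) →
        (latticeLangevinDynamics (fundamentalLatticeRep 2) β').IsSolution (fundamentalRep (Fin 2))
          hW.natFiltration P W U →
        κ t x = P.map (U t)) →
      ∀ (κ₀ : ℝ≥0 → Kernel (GaugeConfig 3 L (Matrix.specialUnitaryGroup (Fin 2) ℂ))
        (GaugeConfig 3 L (Matrix.specialUnitaryGroup (Fin 2) ℂ))) [∀ t, IsMarkovKernel (κ₀ t)],
      (∀ (t : ℝ≥0) (x : GaugeConfig 3 L (Matrix.specialUnitaryGroup (Fin 2) ℂ))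
        (Ω : Type) [MeasurableSpace Ω] (P : Measure Ω) [IsProbabilityMeasure P]
        (W : ℝ≥0 → Ω → (Edge 3 L × NoiseIdx 2 → ℝ)) (hW : IsFlatBrownian W P)
        (U : ℝ≥0 → Ω → GaugeConfig 3 L (Matrix.specialUnitaryGroup (Fin 2) ℂ)),
        (∀ ω, U 0 ω = x) →
        (latticeLangevinDynamics (fundamentalLatticeRep 2) 0).IsSolution (fundamentalRep (Fin 2))
          hW.natFiltration P W U →
        κ₀ t x = P.map (U t)) →
      ∀ (u : GaugeConfig 3 L (Matrix.specialUnitaryGroup (Fin 2) ℂ) → ℝ), Continuous u → ∀ h : ℝ≥0,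
        (∫ x, u x * u x ∂(wilsonMeasure (d := 3) (L := L) (fundamentalRep (Fin 2)) β')) -
            ∫ x, u x * (∫ y, u y ∂(κ h x)) ∂(wilsonMeasure (d := 3) (L := L) (fundamentalRep (Fin 2)) β') ≤
          C * Real.exp (K * h) * ((∫ x, u x * u x ∂(wilsonMeasure (d := 3) (L := L) (fundamentalRep (Fin 2)) 0)) -
            ∫ x, u x * (∫ y, u y ∂(κ₀ h x)) ∂(wilsonMeasure (d := 3) (L := L) (fundamentalRep (Fin 2)) 0)) ∧
        (∫ x, u x * u x ∂(wilsonMeasure (d := 3) (L := L) (fundamentalRep (Fin 2)) 0)) -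
            ∫ x, u x * (∫ y, u y ∂(κ₀ h x)) ∂(wilsonMeasure (d := 3) (L := L) (fundamentalRep (Fin 2)) 0) ≤
          C * Real.exp (K * h) * ((∫ x, u x * u x ∂(wilsonMeasure (d := 3) (L := L) (fundamentalRep (Fin 2)) β')) -
            ∫ x, u x * (∫ y, u y ∂(κ h x)) ∂(wilsonMeasure (d := 3) (L := L) (fundamentalRep (Fin 2)) β')) := by
  classical
  haveI := secondCountableTopology_su2
  haveI := borelSpace_config L
  obtain ⟨K, M, hcmp⟩ := exists_transition_integral_le_exp_mul_beta_zero L β'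
  obtain ⟨a, ha, hμle, hπle⟩ := wilsonMeasure_le_smul_pi_haar_and (L := L) β'
  rw [← wilsonMeasure_zero_eq_pi (L := L)] at hμle hπle
  refine ⟨K, a * Real.exp M, by positivity, fun κ _ hreal κ₀ _ hreal₀ u hu h => ?_⟩
  set μ : Measure (GaugeConfig 3 L (Matrix.specialUnitaryGroup (Fin 2) ℂ)) :=
    wilsonMeasure (d := 3) (L := L) (fundamentalRep (Fin 2)) β' with hμ
  set μ₀ : Measure (GaugeConfig 3 L (Matrix.specialUnitaryGroup (Fin 2) ℂ)) :=
    wilsonMeasure (d := 3) (L := L) (fundamentalRep (Fin 2)) 0 with hμ₀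
  haveI : IsProbabilityMeasure μ :=
    isProbabilityMeasure_wilsonMeasure (d := 3) (L := L) (fundamentalRep (Fin 2)) (continuous_fundamentalRep (Fin 2)) β'
  haveI : IsProbabilityMeasure μ₀ :=
    isProbabilityMeasure_wilsonMeasure (d := 3) (L := L) (fundamentalRep (Fin 2)) (continuous_fundamentalRep (Fin 2)) 0
  -- the two double-integral forms
  rw [dirichletScale_eq_half_double_integral L β' κ hreal h hu, dirichletScale_eq_half_double_integral L 0 κ₀ hreal₀ h hu]
  set g : GaugeConfig 3 L (Matrix.specialUnitaryGroup (Fin 2) ℂ) → ℝ := fun x => ∫ y, (u x - u y) ^ 2 ∂(κ h x) with hg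
  set g₀ : GaugeConfig 3 L (Matrix.specialUnitaryGroup (Fin 2) ℂ) → ℝ := fun x => ∫ y, (u x - u y) ^ 2 ∂(κ₀ h x) with hg₀
  obtain ⟨hgc, hg0⟩ := continuous_integral_sub_sq_transition L β' κ hreal h hu
  obtain ⟨hg₀c, hg₀0⟩ := continuous_integral_sub_sq_transition L 0 κ₀ hreal₀ h hu
  -- pointwise comparison of `g` and `g₀`
  have hpt : ∀ x, g x ≤ Real.exp (K * h + M) * g₀ x ∧ g₀ x ≤ Real.exp (K * h + M) * g x := fun x =>
    hcmp κ hreal κ₀ hreal₀ (fun y => (u x - u y) ^ 2) ((continuous_const.sub hu).pow 2) (fun y => sq_nonneg _) x h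
  have hexp : Real.exp (K * h + M) = Real.exp M * Real.exp (K * h) := by rw [← Real.exp_add]; ring_nf
  have hE0 : 0 ≤ Real.exp (K * h + M) := (Real.exp_pos _).le
  constructor
  · -- `∫ g dμ ≤ e^{Kh+M} ∫ g₀ dμ ≤ e^{Kh+M} a ∫ g₀ dμ₀`
    have h1 : ∫ x, g x ∂μ ≤ Real.exp (K * h + M) * ∫ x, g₀ x ∂μ := by
      rw [← integral_const_mul]
      exact integral_mono (integrable_of_continuous_of_compactSpace hgc μ)
        ((integrable_of_continuous_of_compactSpace hg₀c μ).const_mul _) fun x => (hpt x).1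
    have h2 : ∫ x, g₀ x ∂μ ≤ a * ∫ x, g₀ x ∂μ₀ := integral_le_mul_integral_of_le_smul ha.le hμle hg₀c hg₀0
    have h3 : 0 ≤ ∫ x, g₀ x ∂μ₀ := integral_nonneg fun x => hg₀0 x
    calc 1 / 2 * ∫ x, g x ∂μ ≤ 1 / 2 * (Real.exp (K * h + M) * (a * ∫ x, g₀ x ∂μ₀)) := by
          refine mul_le_mul_of_nonneg_left (h1.trans (mul_le_mul_of_nonneg_left h2 hE0)) (by norm_num)
      _ = a * Real.exp M * Real.exp (K * h) * (1 / 2 * ∫ x, g₀ x ∂μ₀) := by rw [hexp]; ring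
  · have h1 : ∫ x, g₀ x ∂μ₀ ≤ Real.exp (K * h + M) * ∫ x, g x ∂μ₀ := by
      rw [← integral_const_mul]
      exact integral_mono (integrable_of_continuous_of_compactSpace hg₀c μ₀)
        ((integrable_of_continuous_of_compactSpace hgc μ₀).const_mul _) fun x => (hpt x).2
    have h2 : ∫ x, g x ∂μ₀ ≤ a * ∫ x, g x ∂μ := integral_le_mul_integral_of_le_smul ha.le hπle hgc hg0
    have h3 : 0 ≤ ∫ x, g x ∂μ := integral_nonneg fun x => hg0 x
    calc 1 / 2 * ∫ x, g₀ x ∂μ₀ ≤ 1 / 2 * (Real.exp (K * h + M) * (a * ∫ x, g x ∂μ)) := by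
          refine mul_le_mul_of_nonneg_left (h1.trans (mul_le_mul_of_nonneg_left h2 hE0)) (by norm_num)
      _ = a * Real.exp M * Real.exp (K * h) * (1 / 2 * ∫ x, g x ∂μ) := by rw [hexp]; ring

end Summit.QuantumFields.YangMills.Theorems.ColdStartUniversality

end
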